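import Literature.Geometry.Lorentzian.TameChartCompactness
import Literature.Geometry.Lorentzian.CoordCurvatureContinuity
import Literature.Geometry.Lorentzian.ChartMetricCoord
import Literature.Geometry.Lorentzian.CurvatureNaturality
import Literature.Geometry.Lorentzian.IsometryProofs
import HarnessLib

/-!
# Pointed `C²_loc` limits of vacuum spacetimes on a chart are vacuum

**Theorem (`NearMinkowskiChart.isRicciFlat_spacetime_of_tendsto`).** Let `Ψₙ : ↥O → 𝓢ₙ` be
smooth `C⁰`-pinched chart maps of RICCI-FLAT spacetimes on a connected open `O ⊆ E4`, and let the
components `Ψ_{φ j}^* g_{φ j}` converge in `C²` at every point of `O` to a near-Minkowski field `G`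
(`NearMinkowskiChart O`). Then the near-Minkowski chart spacetime `(O, G, ∂₀)` is Ricci-flat.

Proof. The pulled-back metric `Ψₙ^* gₙ` on the open submanifold `↥O` (`PseudoRiemannianMetric.comap`
along the immersion `Ψₙ`) has representative `Mₙ = metricInCoords (Ψₙ ∘ (chartAt E4 z₀).symm)`; by
naturality of the Ricci tensor under local diffeomorphisms (`ricci_comap_apply`,
`CurvatureNaturality.lean`) and the identification of the abstract Ricci tensor of a chart metric
with the coordinate Ricci form of its components (`OpensChart.ricci_eq_ricAt`, `ChartMetricCoord.lean`)
we get `ricAt Mₙ = 0` on `O`; `C²` convergence of `M_{φ j}` to `G` at a point gives convergence of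
the 2-jets, so `ricAt G = 0` by continuity of the coordinate curvature in the 2-jet
(`MetricCoord.ricAt_eq_zero_of_tendsto`, `CoordCurvatureContinuity.lean`), and `ricci_eq_ricAt`
again turns this into Ricci-flatness of the limit spacetime.

**Corollary (`Spacetime.exists_nearMinkowskiChart_subconvergesLocallyTo_isRicciFlat`).** In the
local Cheeger–Gromov compactness theorem (`TameChartCompactness.lean`), if the spacetimes `𝓢ₙ` are
Ricci-flat then so is the limit: ω-limits of vacuum developments are vacuum (Petersen 2006, Ch. 10,
§3.2; Anderson 2004, §1: "the vacuum equations pass to `C²` limits").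

## References
* P. Petersen, *Riemannian Geometry*, 2nd ed., GTM 171, Springer 2006, Ch. 10, §3.2. [Petersen2006]
* M. T. Anderson, Cheeger–Gromov theory and applications to general relativity, 2004, §1. [Anderson2004]
* B. O'Neill, *Semi-Riemannian geometry*, 1983, Ch. 3, Prop. 3.59, Lemma 3.52. [ONeill1983]
-/

noncomputable section

set_option maxSynthPendingDepth 3

open Set Metric Filter Topology Function TopologicalSpace
open scoped Manifold ContDiff Topology ENNReal

universe u

namespace Literature.Geometry.Lorentzian

/-! ### From `C²` sup-norm convergence at a point to convergence of the 2-jet -/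

section Jets

variable {F W : Type*} [NormedAddCommGroup F] [NormedSpace ℝ F] [NormedAddCommGroup W]
  [NormedSpace ℝ W]

/-- `‖Dh(x)‖ = ‖D¹h(x)‖` (the first derivative as a `1`-multilinear map). [folklore] -/
theorem norm_fderiv_eq_norm_iteratedFDeriv_one (h : F → W) (x : F) :
    ‖fderiv ℝ h x‖ = ‖iteratedFDeriv ℝ 1 h x‖ := by
  rw [← norm_iteratedFDeriv_fderiv (n := 0), norm_iteratedFDeriv_zero]

/-- `‖D(Dh)(x)‖ = ‖D²h(x)‖`. [folklore] -/
theorem norm_fderiv_fderiv_eq_norm_iteratedFDeriv_two (h : F → W) (x : F) :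
    ‖fderiv ℝ (fderiv ℝ h) x‖ = ‖iteratedFDeriv ℝ 2 h x‖ := by
  rw [← norm_iteratedFDeriv_fderiv (n := 1), ← norm_iteratedFDeriv_fderiv (n := 0),
    norm_iteratedFDeriv_zero]

/-- `2 ≤ ∞` in `ℕ∞ω`. [folklore] -/
private theorem two_le_infty' : (2 : ℕ∞ω) ≤ ((⊤ : ℕ∞) : ℕ∞ω) := WithTop.coe_le_coe.mpr le_top

/-- The second derivative of a difference of maps smooth on an open set. [folklore] -/
theorem fderiv_fderiv_sub_of_contDiffOn {O : Set F} (hO : IsOpen O) {f g : F → W}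
    (hf : ContDiffOn ℝ ∞ f O) (hg : ContDiffOn ℝ ∞ g O) {x : F} (hx : x ∈ O) :
    fderiv ℝ (fderiv ℝ (f - g)) x = fderiv ℝ (fderiv ℝ f) x - fderiv ℝ (fderiv ℝ g) x := by
  have hfd : ∀ y ∈ O, DifferentiableAt ℝ f y := fun y hy ↦
    (hf.contDiffAt (hO.mem_nhds hy)).differentiableAt (by simp)
  have hgd : ∀ y ∈ O, DifferentiableAt ℝ g y := fun y hy ↦
    (hg.contDiffAt (hO.mem_nhds hy)).differentiableAt (by simp)
  have heq : fderiv ℝ (f - g) =ᶠ[𝓝 x] fderiv ℝ f - fderiv ℝ g := by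
    filter_upwards [hO.mem_nhds hx] with y hy
    exact fderiv_sub (hfd y hy) (hgd y hy)
  rw [heq.fderiv_eq]
  have hf2 : DifferentiableAt ℝ (fderiv ℝ f) x :=
    ((((hf.of_le two_le_infty').contDiffAt (hO.mem_nhds hx)).fderiv_right (m := 1)
      (by norm_num)).differentiableAt (by simp))
  have hg2 : DifferentiableAt ℝ (fderiv ℝ g) x :=
    ((((hg.of_le two_le_infty').contDiffAt (hO.mem_nhds hx)).fderiv_right (m := 1)
      (by norm_num)).differentiableAt (by simp))
  exact fderiv_sub hf2 hg2

/-- **`C²` sup-norm convergence at a point gives convergence of the 2-jets**: for maps `Mₙ`, `G`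
smooth on an open `O ∋ x` with `supCkENorm {x} 2 (Mₙ − G) → 0`, the values, first and second
derivatives of `Mₙ` at `x` converge to those of `G`. [folklore] -/
theorem tendsto_jets_of_tendsto_supCkENorm {O : Set F} (hO : IsOpen O) {M : ℕ → F → W} {G : F → W}
    (hM : ∀ n, ContDiffOn ℝ ∞ (M n) O) (hG : ContDiffOn ℝ ∞ G O) {x : F} (hx : x ∈ O)
    (h : Tendsto (fun n ↦ supCkENorm ({x} : Set F) 2 (M n - G)) atTop (𝓝 0)) :
    Tendsto (fun n ↦ M n x) atTop (𝓝 (G x)) ∧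
      Tendsto (fun n ↦ fderiv ℝ (M n) x) atTop (𝓝 (fderiv ℝ G x)) ∧
      Tendsto (fun n ↦ fderiv ℝ (fderiv ℝ (M n)) x) atTop (𝓝 (fderiv ℝ (fderiv ℝ G) x)) := by
  have hMa : ∀ n, ContDiffAt ℝ 2 (M n) x := fun n ↦
    ((hM n).of_le two_le_infty').contDiffAt (hO.mem_nhds hx)
  have hGa : ContDiffAt ℝ 2 G x := (hG.of_le two_le_infty').contDiffAt (hO.mem_nhds hx)
  -- the sup norms dominate the pointwise norms of `Dⁱ(Mₙ − G)(x)`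
  have hdom : ∀ (i : ℕ), i ≤ 2 → Tendsto (fun n ↦ ‖iteratedFDeriv ℝ i (M n - G) x‖) atTop (𝓝 0) := by
    intro i hi
    have hle : ∀ n, ‖iteratedFDeriv ℝ i (M n - G) x‖ₑ ≤ supCkENorm ({x} : Set F) 2 (M n - G) :=
      fun n ↦ enorm_iteratedFDeriv_le_supCkENorm hi (mem_singleton x) _
    have h0 : Tendsto (fun n ↦ ‖iteratedFDeriv ℝ i (M n - G) x‖ₑ) atTop (𝓝 0) :=
      tendsto_of_tendsto_of_tendsto_of_le_of_le tendsto_const_nhds h (fun _ ↦ bot_le) hle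
    have h1 : Tendsto (fun n ↦ (‖iteratedFDeriv ℝ i (M n - G) x‖ₑ).toReal) atTop
        (𝓝 (0 : ℝ≥0∞).toReal) := (ENNReal.tendsto_toReal ENNReal.zero_ne_top).comp h0
    rw [ENNReal.toReal_zero] at h1
    refine h1.congr fun n ↦ ?_
    rw [← ofReal_norm, ENNReal.toReal_ofReal (norm_nonneg _)]
  refine ⟨?_, ?_, ?_⟩
  · exact tendsto_apply_of_tendsto_supCkENorm (k := 2) (mem_singleton x) hMa hGa h
  · rw [tendsto_iff_norm_sub_tendsto_zero]
    refine (hdom 1 (by norm_num)).congr fun n ↦ ?_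
    rw [← norm_fderiv_eq_norm_iteratedFDeriv_one]
    congr 1
    exact fderiv_sub ((hMa n).differentiableAt (by simp)) (hGa.differentiableAt (by simp))
  · rw [tendsto_iff_norm_sub_tendsto_zero]
    refine (hdom 2 le_rfl).congr fun n ↦ ?_
    rw [← norm_fderiv_fderiv_eq_norm_iteratedFDeriv_two]
    congr 1
    exact fderiv_fderiv_sub_of_contDiffOn hO (hM n) hG hx

end Jets

/-! ### The limit chart spacetime: Ricci tensor = coordinate Ricci form of `G` -/

namespace NearMinkowskiChart

variable {O : Opens E4} (L : NearMinkowskiChart O) (hO : IsConnected (O : Set E4))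

/-- The components `G` of a near-Minkowski chart are metric components on `O`
(`MetricCoord.IsMetricOn`). [folklore] -/
theorem isMetricOn : MetricCoord.IsMetricOn L.G (O : Set E4) :=
  OpensChart.isMetricOn_repr (g := L.metric.toPseudoRiemannianMetric) fun _ ↦ rfl

/-- **The Ricci tensor of the near-Minkowski chart metric is the coordinate Ricci form of `G`.**
[cite: ONeill1983, Ch. 3, Lemma 3.52] -/
theorem ricci_metric_eq_ricAt [L.metric.toPseudoRiemannianMetric.HasLeviCivita] (x : O) (Y Z : E4) :
    L.metric.toPseudoRiemannianMetric.ricci x Y Z = MetricCoord.ricAt L.G x Y Z :=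
  OpensChart.ricci_eq_ricAt (g := L.metric.toPseudoRiemannianMetric) (fun _ ↦ rfl) x Y Z

/-- **Ricci-flatness of the near-Minkowski chart metric from `ricAt G = 0` on `O`.**
[cite: ONeill1983, Ch. 3, Lemma 3.52] -/
theorem isRicciFlat_metric_of_ricAt_eq_zero (h : ∀ y ∈ (O : Set E4), MetricCoord.ricAt L.G y = 0)
    [L.metric.toPseudoRiemannianMetric.HasLeviCivita] :
    L.metric.toPseudoRiemannianMetric.IsRicciFlat := by
  intro x
  ext Y Z
  rw [L.ricci_metric_eq_ricAt x Y Z, h x.1 x.2]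
  rfl

/-- **Ricci-flatness of the near-Minkowski chart SPACETIME from `ricAt G = 0` on `O`** (its metric
is `L.metric`). [cite: ONeill1983, Ch. 3, Lemma 3.52] -/
theorem isRicciFlat_spacetime_of_ricAt_eq_zero (h : ∀ y ∈ (O : Set E4), MetricCoord.ricAt L.G y = 0)
    [inst : (L.spacetime hO).metric.toPseudoRiemannianMetric.HasLeviCivita] :
    (L.spacetime hO).metric.toPseudoRiemannianMetric.IsRicciFlat := by
  haveI : L.metric.toPseudoRiemannianMetric.HasLeviCivita := inst
  exact L.isRicciFlat_metric_of_ricAt_eq_zero h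

end NearMinkowskiChart

/-! ### The pulled-back metric of a pinched chart: representative and Ricci-flatness -/

namespace Spacetime

variable (𝓢 : Spacetime.{u} 4) {O : Opens E4}

/-- A smooth `C⁰`-pinched chart map has injective differentials. [cite: ONeill1983, Ch. 5, Lemma 5.26] -/
theorem injective_mfderiv_of_norm_deviationExtend_lt_one (Ψ : O → 𝓢.carrier)
    (hΨ : ContMDiff 𝓘(ℝ, E4) (𝓡 4) ∞ Ψ)
    (h : ∀ y ∈ (O : Set E4), ‖𝓢.deviationExtend (Minkowski.backgroundOn O) Ψ y‖ < 1) (z : O) :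
    Injective (mfderiv 𝓘(ℝ, E4) (𝓡 4) Ψ z) := by
  have hd : MDifferentiableAt 𝓘(ℝ, E4) (𝓡 4) Ψ ⟨z.1, z.2⟩ := (hΨ z).mdifferentiableAt (by simp)
  have hinj := 𝓢.injective_mfderiv_of_metricInCoords_nondegenerate
    (𝓢.metricInCoords_nondegenerate_of_norm_sub_lt_one
      ((𝓢.norm_metricInCoords_comp_chartAt_symm_sub (Minkowski.backgroundOn O) Ψ z hΨ z.2).trans_lt
        (h z z.2)))
  intro v w hvw
  apply hinj
  rw [𝓢.mfderiv_comp_chartAt_symm_apply (Minkowski.backgroundOn O) Ψ z z.2 hd v,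
    𝓢.mfderiv_comp_chartAt_symm_apply (Minkowski.backgroundOn O) Ψ z z.2 hd w]
  exact hvw

/-- **The pulled-back metric `Ψ^* g` of a smooth immersed chart** (e.g. a pinched one,
`injective_mfderiv_of_norm_deviationExtend_lt_one`), a smooth pseudo-Riemannian metric on the open
submanifold `↥O` (`PseudoRiemannianMetric.comap` along the immersion `Ψ`).
[cite: ONeill1983, Ch. 3, pp. 90–91] -/
abbrev immersedChartMetric (Ψ : O → 𝓢.carrier) (hΨ : ContMDiff 𝓘(ℝ, E4) (𝓡 4) ∞ Ψ)
    (hinj : ∀ z : O, Injective (mfderiv 𝓘(ℝ, E4) (𝓡 4) Ψ z)) :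
    PseudoRiemannianMetric 𝓘(ℝ, E4) ∞ E4 (TangentSpace 𝓘(ℝ, E4) : O → Type _) :=
  𝓢.metric.toPseudoRiemannianMetric.comap PseudoRiemannianMetric.contMDiff_pullbackBilin_holds Ψ
    (hΨ.of_le (by exact_mod_cast le_rfl)) hinj rfl

/-- **The representative of the pulled-back metric is `metricInCoords (Ψ ∘ (chartAt E4 z₀).symm)`.**
[cite: ONeill1983, Ch. 3, Def. 3.9] -/
theorem immersedChartMetric_val (Ψ : O → 𝓢.carrier) (hΨ : ContMDiff 𝓘(ℝ, E4) (𝓡 4) ∞ Ψ)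
    (hinj : ∀ z : O, Injective (mfderiv 𝓘(ℝ, E4) (𝓡 4) Ψ z)) (z₀ y : O) :
    (𝓢.immersedChartMetric Ψ hΨ hinj).val y = 𝓢.metricInCoords (Ψ ∘ (chartAt E4 z₀).symm) y := by
  ext v w
  exact (𝓢.metricInCoords_comp_chartAt_symm_apply (Minkowski.backgroundOn O) Ψ z₀ y.2
    ((hΨ ⟨y.1, y.2⟩).mdifferentiableAt (by simp)) v w).symm

/-- **The components of an immersed chart of a Ricci-flat spacetime have vanishing coordinate
Ricci form**: `ricAt (metricInCoords (Ψ ∘ (chartAt E4 z₀).symm)) y = 0` on `O` (naturality of the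
Ricci tensor under the immersion `Ψ`, then `ricci_eq_ricAt`). [cite: ONeill1983, Ch. 3, Prop. 3.59] -/
theorem ricAt_metricInCoords_eq_zero_of_isRicciFlat (Ψ : O → 𝓢.carrier)
    (hΨ : ContMDiff 𝓘(ℝ, E4) (𝓡 4) ∞ Ψ) (hinj : ∀ z : O, Injective (mfderiv 𝓘(ℝ, E4) (𝓡 4) Ψ z))
    (hvac : ∀ [𝓢.metric.toPseudoRiemannianMetric.HasLeviCivita],
      𝓢.metric.toPseudoRiemannianMetric.IsRicciFlat)
    (z₀ : O) {y : E4} (hy : y ∈ (O : Set E4)) :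
    MetricCoord.ricAt (𝓢.metricInCoords (Ψ ∘ (chartAt E4 z₀).symm)) y = 0 := by
  haveI := 𝓢.metric.toPseudoRiemannianMetric.hasLeviCivita
  haveI := (𝓢.immersedChartMetric Ψ hΨ hinj).hasLeviCivita
  ext Y Z
  have h1 := OpensChart.ricci_eq_ricAt (g := 𝓢.immersedChartMetric Ψ hΨ hinj)
    (G := 𝓢.metricInCoords (Ψ ∘ (chartAt E4 z₀).symm))
    (fun y' ↦ 𝓢.immersedChartMetric_val Ψ hΨ hinj z₀ y') ⟨y, hy⟩ Y Z
  have h2 := 𝓢.metric.toPseudoRiemannianMetric.ricci_comap_apply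
    PseudoRiemannianMetric.contMDiff_pullbackBilin_holds (hΨ.of_le (by exact_mod_cast le_rfl))
    hinj rfl ⟨y, hy⟩ Y Z
  have h3 : 𝓢.metric.toPseudoRiemannianMetric.ricci (Ψ ⟨y, hy⟩) = 0 := hvac (Ψ ⟨y, hy⟩)
  change (𝓢.immersedChartMetric Ψ hΨ hinj).ricci ⟨y, hy⟩ Y Z = _ at h2
  rw [← h1, h2, h3]
  rfl

/-- The components of a smooth immersed chart are metric components on `O`
(`MetricCoord.IsMetricOn`). [folklore] -/
theorem isMetricOn_metricInCoords (Ψ : O → 𝓢.carrier) (hΨ : ContMDiff 𝓘(ℝ, E4) (𝓡 4) ∞ Ψ)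
    (hinj : ∀ z : O, Injective (mfderiv 𝓘(ℝ, E4) (𝓡 4) Ψ z)) (z₀ : O) :
    MetricCoord.IsMetricOn (𝓢.metricInCoords (Ψ ∘ (chartAt E4 z₀).symm)) (O : Set E4) :=
  OpensChart.isMetricOn_repr (g := 𝓢.immersedChartMetric Ψ hΨ hinj)
    fun y' ↦ 𝓢.immersedChartMetric_val Ψ hΨ hinj z₀ y'

variable {𝓢ₙ : ℕ → Spacetime.{u} 4}

/-- **Coordinate form of "limits of vacuum charts are vacuum"**: if the components of smooth
immersed charts of Ricci-flat spacetimes converge in `C²` at every point of `O` to smooth metric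
components `G`, then `ricAt G = 0` on `O` (continuity of the coordinate Ricci form in the `2`-jet,
`MetricCoord.ricAt_eq_zero_of_tendsto`). [cite: Petersen2006, Ch. 10 §3.2] -/
theorem ricAt_eq_zero_of_tendsto_metricInCoords (Ψ : ∀ n, O → (𝓢ₙ n).carrier)
    (hΨ : ∀ n, ContMDiff 𝓘(ℝ, E4) (𝓡 4) ∞ (Ψ n))
    (hinj : ∀ n (z : O), Injective (mfderiv 𝓘(ℝ, E4) (𝓡 4) (Ψ n) z))
    (hvac : ∀ n, ∀ [(𝓢ₙ n).metric.toPseudoRiemannianMetric.HasLeviCivita],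
      (𝓢ₙ n).metric.toPseudoRiemannianMetric.IsRicciFlat)
    {G : E4 → E4 →L[ℝ] E4 →L[ℝ] ℝ} (hG : ContDiffOn ℝ ∞ G O)
    (hGm : MetricCoord.IsMetricOn G (O : Set E4)) {φ : ℕ → ℕ} (z₀ : O)
    (hlim : ∀ y ∈ (O : Set E4), Tendsto (fun j ↦ supCkENorm ({y} : Set E4) 2
      ((𝓢ₙ (φ j)).metricInCoords (Ψ (φ j) ∘ (chartAt E4 z₀).symm) - G)) atTop (𝓝 0))
    {y : E4} (hy : y ∈ (O : Set E4)) : MetricCoord.ricAt G y = 0 := by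
  let M : ℕ → E4 → E4 →L[ℝ] E4 →L[ℝ] ℝ := fun j ↦
    (𝓢ₙ (φ j)).metricInCoords (Ψ (φ j) ∘ (chartAt E4 z₀).symm)
  have hMs : ∀ j, ContDiffOn ℝ ∞ (M j) O := fun j ↦
    (𝓢ₙ (φ j)).contDiffOn_metricInCoords O.2
      ((𝓢ₙ (φ j)).contMDiffOn_comp_chartAt_symm (Minkowski.backgroundOn O) (Ψ (φ j)) z₀ (hΨ _))
  obtain ⟨h0, h1, h2⟩ := tendsto_jets_of_tendsto_supCkENorm O.2 hMs hG hy (hlim y hy)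
  exact MetricCoord.ricAt_eq_zero_of_tendsto (l := atTop) (Gs := M)
    (fun j ↦ (𝓢ₙ (φ j)).isMetricOn_metricInCoords (Ψ (φ j)) (hΨ _) (hinj _) z₀) hGm hy
    h0 h1 h2 (Eventually.of_forall fun j ↦
      (𝓢ₙ (φ j)).ricAt_metricInCoords_eq_zero_of_isRicciFlat (Ψ (φ j)) (hΨ _) (hinj _) (hvac _)
        z₀ hy)

end Spacetime

/-! ### Vacuum passes to the limit -/

namespace NearMinkowskiChart

variable {𝓢ₙ : ℕ → Spacetime.{u} 4} {O : Opens E4}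

/-- **Pointed `C²_loc` limits of vacuum spacetimes on a chart are vacuum** (module docstring).
[cite: Petersen2006, Ch. 10 §3.2] -/
theorem isRicciFlat_spacetime_of_tendsto (hO : IsConnected (O : Set E4))
    (Ψ : ∀ n, O → (𝓢ₙ n).carrier) (hΨ : ∀ n, ContMDiff 𝓘(ℝ, E4) (𝓡 4) ∞ (Ψ n))
    (hpinch : ∀ n, ∀ y ∈ (O : Set E4),
      ‖(𝓢ₙ n).deviationExtend (Minkowski.backgroundOn O) (Ψ n) y‖ < 1)
    (hvac : ∀ n, ∀ [(𝓢ₙ n).metric.toPseudoRiemannianMetric.HasLeviCivita],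
      (𝓢ₙ n).metric.toPseudoRiemannianMetric.IsRicciFlat)
    (L : NearMinkowskiChart O) {φ : ℕ → ℕ} (z₀ : O)
    (hlim : ∀ y ∈ (O : Set E4), Tendsto (fun j ↦ supCkENorm ({y} : Set E4) 2
      ((𝓢ₙ (φ j)).metricInCoords (Ψ (φ j) ∘ (chartAt E4 z₀).symm) - L.G)) atTop (𝓝 0))
    [(L.spacetime hO).metric.toPseudoRiemannianMetric.HasLeviCivita] :
    (L.spacetime hO).metric.toPseudoRiemannianMetric.IsRicciFlat :=
  L.isRicciFlat_spacetime_of_ricAt_eq_zero hO fun _ hy ↦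
    Spacetime.ricAt_eq_zero_of_tendsto_metricInCoords Ψ hΨ
      (fun n ↦ (𝓢ₙ n).injective_mfderiv_of_norm_deviationExtend_lt_one (Ψ n) (hΨ n) (hpinch n))
      hvac L.contDiffOn L.isMetricOn z₀ hlim hy

end NearMinkowskiChart

namespace Spacetime

variable {𝓢ₙ : ℕ → Spacetime.{u} 4} {pₙ : ∀ n, (𝓢ₙ n).carrier} {O : Opens E4}

/-- **Local Cheeger–Gromov compactness for tame VACUUM spacetimes: the limit is vacuum.** Under the
hypotheses of `exists_nearMinkowskiChart_subconvergesLocallyTo`, if every `𝓢ₙ` is Ricci-flat then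
the near-Minkowski chart spacetime of the limit components is Ricci-flat, besides being a pointed
`Cᵏ_loc` limit for every `k`. [cite: Petersen2006, Ch. 10 §3.2] -/
theorem exists_nearMinkowskiChart_subconvergesLocallyTo_isRicciFlat (hO : IsConnected (O : Set E4))
    {y₀ : E4} (hy₀ : y₀ ∈ (O : Set E4)) (Ψ : ∀ n, O → (𝓢ₙ n).carrier)
    (hΨ : ∀ n, ContMDiff 𝓘(ℝ, E4) (𝓡 4) ∞ (Ψ n)) (hinj : ∀ n, Injective (Ψ n))
    (hcentre : ∀ n, Ψ n ⟨y₀, hy₀⟩ = pₙ n)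
    (hfut : ∀ n, (𝓢ₙ n).timeOrientation.IsFutureDirected
      (mfderiv 𝓘(ℝ, E4) (𝓡 4) (Ψ n) ⟨y₀, hy₀⟩ (E4.basisVector 0)))
    {θ : ℝ} (hθ : θ < 1)
    (hpinch : ∀ n, ∀ y ∈ (O : Set E4),
      ‖(𝓢ₙ n).deviationExtend (Minkowski.backgroundOn O) (Ψ n) y‖ ≤ θ)
    (hbound : ∀ k : ℕ, ∃ Λ : ℝ≥0∞, Λ ≠ ⊤ ∧
      ∀ n, supCkENorm (O : Set E4) k ((𝓢ₙ n).deviationExtend (Minkowski.backgroundOn O) (Ψ n)) ≤ Λ)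
    (hvac : ∀ n, ∀ [(𝓢ₙ n).metric.toPseudoRiemannianMetric.HasLeviCivita],
      (𝓢ₙ n).metric.toPseudoRiemannianMetric.IsRicciFlat) :
    ∃ (L : NearMinkowskiChart O) (φ : ℕ → ℕ), StrictMono φ ∧
      (∀ y ∈ (O : Set E4), ‖L.G y - Minkowski.bilin‖ ≤ θ) ∧
      (∀ (k : ℕ) (C : ℝ≥0∞), (∀ n, supCkENorm (O : Set E4) k
          ((𝓢ₙ n).deviationExtend (Minkowski.backgroundOn O) (Ψ n)) ≤ C) →
        supCkENorm (O : Set E4) k (L.G - fun _ ↦ Minkowski.bilin) ≤ C) ∧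
      (∀ (k : ℕ), ∀ K ⊆ (O : Set E4), IsCompact K →
        Tendsto (fun j ↦ supCkENorm K k
          ((𝓢ₙ (φ j)).deviationExtend (Minkowski.backgroundOn O) (Ψ (φ j)) -
            (L.G - fun _ ↦ Minkowski.bilin))) atTop (𝓝 0)) ∧
      (∀ k : ℕ, SubconvergesLocallyTo 𝓢ₙ pₙ (L.spacetime hO) ⟨y₀, hy₀⟩ k) ∧
      ∀ [(L.spacetime hO).metric.toPseudoRiemannianMetric.HasLeviCivita],
        (L.spacetime hO).metric.toPseudoRiemannianMetric.IsRicciFlat := by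
  obtain ⟨L, φ, hφ, hGpinch, hbd, hconvDev, hsub⟩ :=
    exists_nearMinkowskiChart_subconvergesLocallyTo hO hy₀ Ψ hΨ hinj hcentre hfut hθ hpinch hbound
  refine ⟨L, φ, hφ, hGpinch, hbd, hconvDev, hsub, ?_⟩
  intro _
  refine L.isRicciFlat_spacetime_of_tendsto hO Ψ hΨ (fun n y hy ↦ (hpinch n y hy).trans_lt hθ)
    hvac (φ := φ) ⟨y₀, hy₀⟩ fun y hy ↦ ?_
  exact tendsto_supCkENorm_metricInCoords_sub_of_deviationExtend Ψ hΨ ⟨y₀, hy₀⟩ L.G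
    (singleton_subset_iff.2 hy) (hconvDev 2 {y} (singleton_subset_iff.2 hy) isCompact_singleton)

end Spacetime

end Literature.Geometry.Lorentzian

end
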